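import Summits.BirchSwinnertonDyer.BirchSwinnertonDyer.Theorems.ResidualThetaTransportAtTwoSignedMuSeedAtTwoPlusTiltOrbitProduct
import HarnessLib

/-!
# Seed crux `SignedMuSeedAtTwoPlus` (stmt-BirchSwinnertonDyer-21438), line `norm-field-tilt`:
# the unit tower `h_m = g^{2^m} = 1 + π^{m+1}·w_m`, `w_m ∉ (π)` (the card's «`h_m − 1 ∈ 2^{m+1}ℤ₄^×`»)

Cell `bsd-wall`, width seat `bsd-wall-rtt-p4-w2` g10; tenth file on the line, on top of p659240 (`…TiltOrbitProduct`,
whose hypotheses `g^{2^m} = 1 + π^{m+1} w_m`, `w_m ∉ (π)` are DISCHARGED here from `g ≡ 1 + π·w₀` with `w̄₀ ∉ {0, −c̄}`).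
HONEST FRAMING: THEOREMS ONLY; closes no item; the line is NOT registered; BSD is NOT proved by this.

## What is proved

In a commutative ring `A` with `2 = π·c` (for `A = ℤ₄ = W(𝔽₄)`, `π = −2`, `c = −1`):
* `pow_two_pow_eq_one_add` — for `g = 1 + π·w₀` and the explicit tower `w_{m+1} = c·w_m + π^m·w_m²` (a `Nat.rec`, no
  definition): `g^{2^m} = 1 + π^{m+1}·w_m` for every `m` (square: `(1 + π^{m+1}w)² = 1 + π^{m+2}(c w + π^{m+1}… )`);
* `levelUnit_not_mem` — if `(π)` is prime, `c ∉ (π)`, `w₀ ∉ (π)` and `w₀ + c ∉ (π)` (for `ℤ₄`: `w̄₀ ∈ 𝔽₄ ∖ 𝔽₂`, which is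
  the card's normalisation `N(g) = −1`, `g ≡ 1 (mod 2)`), then `w_m ∉ (π)` for every `m`
  (`w₁ = w₀(c + w₀)`, and `w_{m+1} ≡ c·w_m (mod π)` for `m ≥ 1`);
* **`oddDigit_of_nonDeg_orbit_of_generator`** — p659240's `oddDigit_of_nonDeg_orbit` with the unit tower discharged:
  the hypotheses on the group element are now only `2 = π c`, `c ∉ (π)`, `g = 1 + π w₀`, `w₀ ∉ (π)`, `w₀ + c ∉ (π)`.

After this file the tilt engine's inference `NonDeg(m₀) ⟹ OddDigit(m ≥ m₀+2)` for `Z_m = ∏_{j<2^m} θ([gʲ]‾t)` rests on: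
the Lubin–Tate datum and Weierstrass model (RTT `…RelativeLubinTate*`), `a₁ ≡ 0`, and — stub S1 proper — the series
`θ = θ̄^ρ`, `Z_m ≠ 0`, `ord Z_m = 2^{m+2}`, the digits/membership; plus `NonDeg(m₀)` (stub S4). [folklore]
-/

noncomputable section

set_option autoImplicit false
set_option linter.dupNamespace false

open PowerSeries
open Literature.NumberTheory.GaloisRepresentations

namespace Summit.BirchSwinnertonDyer.BirchSwinnertonDyer.Theorems.SignedMuAtTwo.Tilt

variable {A : Type*} [CommRing A] {π : A}

/-- The unit tower, one step: `w_{m+1} = c·w_m + π^m·w_m²` (`Nat.rec`). [folklore] -/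
theorem levelUnit_succ (c w₀ : A) (m : ℕ) :
    (Nat.rec w₀ (fun m wm => c * wm + π ^ m * wm ^ 2) (m + 1) : A) =
      c * Nat.rec w₀ (fun m wm => c * wm + π ^ m * wm ^ 2) m +
        π ^ m * (Nat.rec w₀ (fun m wm => c * wm + π ^ m * wm ^ 2) m : A) ^ 2 := rfl

/-- **`g^{2^m} = 1 + π^{m+1}·w_m`** for `g = 1 + π·w₀`, `2 = π·c`, and the tower `w_{m+1} = c·w_m + π^m·w_m²`.
[folklore] -/
theorem pow_two_pow_eq_one_add {c : A} (h2 : (2 : A) = π * c) {g w₀ : A} (hg : g = 1 + π * w₀) (m : ℕ) :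
    g ^ (2 ^ m) = 1 + π ^ (m + 1) * (Nat.rec w₀ (fun m wm => c * wm + π ^ m * wm ^ 2) m : A) := by
  induction m with
  | zero => simpa using hg
  | succ m ih =>
    rw [pow_succ, pow_mul, ih, levelUnit_succ]
    linear_combination (π ^ (m + 1) * (Nat.rec w₀ (fun m wm => c * wm + π ^ m * wm ^ 2) m : A)) * h2

/-- **The tower stays in the units modulo `π`**: `(π)` prime, `c ∉ (π)`, `w₀ ∉ (π)`, `w₀ + c ∉ (π)` ⟹ `w_m ∉ (π)` for
all `m` (`w₁ = w₀·(c + w₀)`; `w_{m+1} ≡ c·w_m` for `m ≥ 1`). [folklore] -/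
theorem levelUnit_not_mem (hprime : (Ideal.span {π}).IsPrime) {c w₀ : A} (hc : c ∉ Ideal.span {π})
    (hw₀ : w₀ ∉ Ideal.span {π}) (hw₀c : w₀ + c ∉ Ideal.span {π}) (m : ℕ) :
    (Nat.rec w₀ (fun m wm => c * wm + π ^ m * wm ^ 2) m : A) ∉ Ideal.span {π} := by
  induction m with
  | zero => simpa using hw₀
  | succ m ih =>
    rw [levelUnit_succ]
    rcases Nat.eq_zero_or_pos m with hm | hm
    · subst hm
      simp only [pow_zero, one_mul]
      change c * w₀ + w₀ ^ 2 ∉ Ideal.span {π}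
      rw [show c * w₀ + w₀ ^ 2 = w₀ * (w₀ + c) by ring]
      exact fun h => (hprime.mem_or_mem h).elim hw₀ hw₀c
    · intro h
      have hπ : π ^ m * (Nat.rec w₀ (fun m wm => c * wm + π ^ m * wm ^ 2) m : A) ^ 2 ∈ Ideal.span {π} :=
        Ideal.mul_mem_right _ _ (Ideal.pow_mem_of_mem _ (Ideal.mem_span_singleton_self π) _ hm)
      have hcw : c * (Nat.rec w₀ (fun m wm => c * wm + π ^ m * wm ^ 2) m : A) ∈ Ideal.span {π} := by
        have := Ideal.sub_mem _ h hπ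
        rwa [add_sub_cancel_right] at this
      exact (hprime.mem_or_mem hcw).elim hc ih

/-- **The tilt engine for the orbit product of a generator** (p659240 with the unit tower discharged).  Lubin–Tate datum
`(A, π, 4, f)`, `A/π` a domain, `2 = π·c` with `c ∉ (π)`, Weierstrass model `U/A` (`U.formalGroupLaw = F_f`, `a₁ ≡ 0`),
`g = 1 + π·w₀` with `w₀ ∉ (π)`, `w₀ + c ∉ (π)` (for `ℤ₄`, `π = −2`, `c = −1`: `w̄₀ ∈ 𝔽₄ ∖ 𝔽₂`); `θ ∈ (A/π)⟦t⟧`,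
`Z_m := ∏_{j<2^m} θ([gʲ]‾t)`, `S_m` with `Z_m·S_m = η̄·Z_m'`, `Z_m ≠ 0`, `ord Z_m = 2^{m+2}`, digits
`Z_m ≡ P_m(s_m) (mod t^{3·4^m})`.  Then `ord S_{m₀} = a₀`, `a₀ + 2 < 4^{m₀+1}` ⟹ `OddDigit(m)` for every `m ≥ m₀ + 2`.
[folklore] -/
theorem oddDigit_of_nonDeg_orbit_of_generator (hA4 : LubinTate.IsLTRing π 4) {f4 : PowerSeries A}
    (hf4 : LubinTate.IsLTSeries π 4 f4) [IsDomain (A ⧸ Ideal.span {π})]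
    {c : A} (h2 : (2 : A) = π * c) (hc : c ∉ Ideal.span {π})
    (U : WeierstrassCurve A) (hU : U.formalGroupLaw = LubinTate.ltF hA4 hf4)
    (ha₁ : (U.map (Ideal.Quotient.mk (Ideal.span {π}))).a₁ = 0)
    {g w₀ : A} (hg : g = 1 + π * w₀) (hw₀ : w₀ ∉ Ideal.span {π}) (hw₀c : w₀ + c ∉ Ideal.span {π})
    (θ : PowerSeries (A ⧸ Ideal.span {π}))
    (S s : ℕ → PowerSeries (A ⧸ Ideal.span {π})) (P : ℕ → Polynomial (A ⧸ Ideal.span {π}))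
    (hZ : ∀ m, ∏ j ∈ Finset.range (2 ^ m),
        (θ.subst ((LubinTate.hom hA4 hf4 hf4 (g ^ j)).map (Ideal.Quotient.mk (Ideal.span {π}))) :
          PowerSeries (A ⧸ Ideal.span {π})) ≠ 0)
    (hZS : ∀ m, (∏ j ∈ Finset.range (2 ^ m),
        (θ.subst ((LubinTate.hom hA4 hf4 hf4 (g ^ j)).map (Ideal.Quotient.mk (Ideal.span {π}))) :
          PowerSeries (A ⧸ Ideal.span {π}))) * S m =
      (U.map (Ideal.Quotient.mk (Ideal.span {π}))).formalEta *
        d⁄dX (A ⧸ Ideal.span {π}) (∏ j ∈ Finset.range (2 ^ m),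
          (θ.subst ((LubinTate.hom hA4 hf4 hf4 (g ^ j)).map (Ideal.Quotient.mk (Ideal.span {π}))) :
            PowerSeries (A ⧸ Ideal.span {π}))))
    (hZord : ∀ m, PowerSeries.order (∏ j ∈ Finset.range (2 ^ m),
        (θ.subst ((LubinTate.hom hA4 hf4 hf4 (g ^ j)).map (Ideal.Quotient.mk (Ideal.span {π}))) :
          PowerSeries (A ⧸ Ideal.span {π}))) = (2 ^ (m + 2) : ℕ))
    (hmem : ∀ m, (X : PowerSeries (A ⧸ Ideal.span {π})) ^ (3 * 4 ^ m) ∣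
      (∏ j ∈ Finset.range (2 ^ m),
        (θ.subst ((LubinTate.hom hA4 hf4 hf4 (g ^ j)).map (Ideal.Quotient.mk (Ideal.span {π}))) :
          PowerSeries (A ⧸ Ideal.span {π}))) - Polynomial.aeval (s m) (P m))
    {m₀ a₀ : ℕ} (ha₀ : (S m₀).order = a₀) (hnd : a₀ + 2 < 4 ^ (m₀ + 1))
    {m : ℕ} (hm : m₀ + 2 ≤ m) : ∃ i, Odd i ∧ (P m).coeff i ≠ 0 :=
  have hprime : (Ideal.span {π}).IsPrime := (Ideal.Quotient.isDomain_iff_prime _).mp inferInstance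
  oddDigit_of_nonDeg_orbit hA4 hf4 U hU ha₁ g (fun m => Nat.rec w₀ (fun m wm => c * wm + π ^ m * wm ^ 2) m)
    (pow_two_pow_eq_one_add h2 hg) (levelUnit_not_mem hprime hc hw₀ hw₀c) θ S s P hZ hZS hZord hmem ha₀ hnd hm

end Summit.BirchSwinnertonDyer.BirchSwinnertonDyer.Theorems.SignedMuAtTwo.Tilt

end
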